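import Mathlib
import HarnessLib
import Literature.MathematicalPhysics.QuantumLattice.FermiRG.BGM2003Sectors
import Summits.HubbardSuperconductivity.HubbardSuperconductivity.Theorems.KLProgrammeH10TwoPointLimitPerturbedFermiRadiusAccel
import Summits.HubbardSuperconductivity.HubbardSuperconductivity.Theorems.KLProgrammeH10TwoPointLimitPerturbedFermiRadiusCurvature
import Summits.HubbardSuperconductivity.HubbardSuperconductivity.Theorems.KLProgrammePerturbedFermiCurveDefs

/-!
# Route `KLProgramme` — K1/K3 (stmt-HubbardSuperconductivity-19938 / 20437), located item «(L−3)-FRAME-UNIFORM-c», datum (u4)′: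
# the SHELL-UNIFORM radius data of the chart `u₂ θ e := perturbedFermiRadius δ (μ + e) θ` in BGM 2003's vocabulary

Cell gate-hubbard-kl, seat p4 (C5a), g12.  The explicit-constant parallelogram lemma `FermiRG.BGM2003.lemma75_parallelogram_of_bounds`
(BGM 2003 Lemma 7.5, uniform twin) asks, on the shell `|e| ≤ e₀`, for: a radius lower bound `c_u ≤ u`, a curvature lower bound
`c_κ ≤ curvature u`, and ONE bound `M` on `|u|, |u′|, |u″|` (`radiusDeriv`, `radiusDeriv₂`).  For the chart of the perturbed curve
`{ε₀ + δ = μ + e}` (`δ ∈ C²`, `|δ| ≤ κ₀`, `‖Dδ‖ ≤ κ₁ < Dt_min`, `‖D²δ‖ ≤ κ₂` on the closed square, `[μ − κ₀ − e₀, μ + κ₀ + e₀] ⊂ [a, b]`) these are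
the lineage's level-wise facts `umin_le_perturbedFermiRadius`, `root_le_pi_mul_sqrt_two`, `abs_deriv_le`, `abs_second_deriv_le`,
`polarCurvature_perturbed_ge` read at the level `μ + e`, with constants EXPLICIT in `B, κ₁, κ₂` (and free of `δ, μ, e₀`):

* `chart_radius_ge` (`u_min ≤ u`), `chart_radius_bounds` (`|u|, |u′|, |u″| ≤ M := π√2 + (4 + κ₁)π√2/(Dt_min − κ₁) + U₂`),
  `chart_curvature_ge` (`u_min h_min/((4 + κ₁)(2S_E)³) ≤ 1/r` under the convexity margin `h_min ≤ 2h_E − κ₂S_E²`).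

Everything is PROVED; no definitions, no named facts.  References: BGM 2003 §1.2 (2.8a), §7.1 (A1.6)–(A1.7), §7.3 Lemma 7.5
[cite: BenfattoGiulianiMastropietro2003]; BGM 2006 §2.4 Lemma 2.1 (2.40)–(2.41) [cite: BenfattoGiulianiMastropietro2006].
-/

noncomputable section

namespace Summit.HubbardSuperconductivity.HubbardSuperconductivity.Theorems.PerturbedFermiCurve

set_option linter.dupNamespace false -- summit = problem name (single-conjunct summit), D-0017

open Real Set
open Literature.MathematicalPhysics.QuantumLattice Literature.MathematicalPhysics.QuantumLattice.BandSectorCounting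
open Literature.MathematicalPhysics.QuantumLattice.FermiRG

/-! ## §1 The chart's radius derivatives are the level-wise angular derivatives -/

/-- `u′(θ, e)` of the chart is `deriv (perturbedFermiRadius δ (μ + e)) θ`. [folklore] -/
theorem radiusDeriv_chart (δ : (Fin 2 → ℝ) → ℝ) (μ θ e : ℝ) :
    BGM2003.radiusDeriv (fun ϑ e => perturbedFermiRadius δ (μ + e) ϑ) θ e = deriv (perturbedFermiRadius δ (μ + e)) θ := rfl

/-- `u″(θ, e)` of the chart is `deriv (deriv (perturbedFermiRadius δ (μ + e))) θ`. [folklore] -/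
theorem radiusDeriv₂_chart (δ : (Fin 2 → ℝ) → ℝ) (μ θ e : ℝ) :
    BGM2003.radiusDeriv₂ (fun ϑ e => perturbedFermiRadius δ (μ + e) ϑ) θ e = deriv (deriv (perturbedFermiRadius δ (μ + e))) θ := rfl

/-- `1/r(θ, e)` of the chart is `(u² + 2u′² − uu″)/√(u′² + u²)³` at the level `μ + e`. [cite: BenfattoGiulianiMastropietro2003, §7.1 (A1.7)] -/
theorem curvature_chart (δ : (Fin 2 → ℝ) → ℝ) (μ θ e : ℝ) :
    BGM2003.curvature (fun ϑ e => perturbedFermiRadius δ (μ + e) ϑ) θ e =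
      (perturbedFermiRadius δ (μ + e) θ ^ 2 + 2 * deriv (perturbedFermiRadius δ (μ + e)) θ ^ 2 -
          perturbedFermiRadius δ (μ + e) θ * deriv (deriv (perturbedFermiRadius δ (μ + e))) θ) /
        Real.sqrt (deriv (perturbedFermiRadius δ (μ + e)) θ ^ 2 + perturbedFermiRadius δ (μ + e) θ ^ 2) ^ 3 := rfl

/-! ## §2 Shell-uniform bounds -/

section Shell

variable {a b : ℝ} (B : BandBounds a b) {δ : (Fin 2 → ℝ) → ℝ} (hδs : ContDiff ℝ 2 δ)
  {κ₀ κ₁ κ₂ μ e₀ : ℝ} (hδ : ∀ k : Fin 2 → ℝ, (∀ i, |k i| ≤ π) → |δ k| ≤ κ₀) (hlo : a ≤ μ - κ₀ - e₀) (hhi : μ + κ₀ + e₀ ≤ b)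
  (hκ : ∀ k : Fin 2 → ℝ, (∀ i, |k i| ≤ π) → ‖fderiv ℝ δ k‖ ≤ κ₁) (hκ₁ : κ₁ < B.Dtmin)
  (hκ₂ : ∀ k : Fin 2 → ℝ, (∀ i, |k i| ≤ π) → ‖fderiv ℝ (fderiv ℝ δ) k‖ ≤ κ₂)
include B hδs hδ hlo hhi hκ hκ₁ hκ₂

omit B hδs hδ hκ hκ₁ hκ₂ in
/-- Every level of the shell is admissible: `a ≤ μ + e − κ₀`, `μ + e + κ₀ ≤ b` for `|e| ≤ e₀`. [folklore] -/
theorem shell_level_admissible {e : ℝ} (he : |e| ≤ e₀) : a ≤ μ + e - κ₀ ∧ μ + e + κ₀ ≤ b := by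
  have h := abs_le.1 he
  exact ⟨by linarith [h.1], by linarith [h.2]⟩

omit hκ hκ₁ hκ₂ in
/-- **(u1) on the shell**: `u_min ≤ u(θ, e)` for `|e| ≤ e₀`. [folklore] -/
theorem chart_radius_ge : ∀ θ e : ℝ, |e| ≤ e₀ → B.umin ≤ (fun ϑ e => perturbedFermiRadius δ (μ + e) ϑ) θ e := by
  intro θ e he
  obtain ⟨hl, hh⟩ := shell_level_admissible hlo hhi he
  exact umin_le_perturbedFermiRadius B hδs.continuous hδ hl hh θ

/-- **The bound `M`** on `|u|, |u′|, |u″|` along the shell: `M = π√2 + (4 + κ₁)π√2/(Dt_min − κ₁) + U₂`, `U₂` the acceleration bound of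
`abs_second_deriv_le`. [cite: BenfattoGiulianiMastropietro2006, §2.4 Lemma 2.1 (2.40)–(2.41)] -/
theorem chart_radius_bounds : ∀ θ e : ℝ, |e| ≤ e₀ →
    |(fun ϑ e => perturbedFermiRadius δ (μ + e) ϑ) θ e| ≤
        π * Real.sqrt 2 + (4 + κ₁) * (π * Real.sqrt 2) / (B.Dtmin - κ₁) +
          ((4 + κ₂) * (B.smax + κ₁ * (π * Real.sqrt 2 + 2 * B.smax) / (B.Dtmin - κ₁)) ^ 2 +
            (8 + 2 * κ₁) * ((4 + κ₁) * (π * Real.sqrt 2) / (B.Dtmin - κ₁)) + (4 + κ₁) * (π * Real.sqrt 2)) / (B.Dtmin - κ₁) ∧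
    |BGM2003.radiusDeriv (fun ϑ e => perturbedFermiRadius δ (μ + e) ϑ) θ e| ≤
        π * Real.sqrt 2 + (4 + κ₁) * (π * Real.sqrt 2) / (B.Dtmin - κ₁) +
          ((4 + κ₂) * (B.smax + κ₁ * (π * Real.sqrt 2 + 2 * B.smax) / (B.Dtmin - κ₁)) ^ 2 +
            (8 + 2 * κ₁) * ((4 + κ₁) * (π * Real.sqrt 2) / (B.Dtmin - κ₁)) + (4 + κ₁) * (π * Real.sqrt 2)) / (B.Dtmin - κ₁) ∧
    |BGM2003.radiusDeriv₂ (fun ϑ e => perturbedFermiRadius δ (μ + e) ϑ) θ e| ≤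
        π * Real.sqrt 2 + (4 + κ₁) * (π * Real.sqrt 2) / (B.Dtmin - κ₁) +
          ((4 + κ₂) * (B.smax + κ₁ * (π * Real.sqrt 2 + 2 * B.smax) / (B.Dtmin - κ₁)) ^ 2 +
            (8 + 2 * κ₁) * ((4 + κ₁) * (π * Real.sqrt 2) / (B.Dtmin - κ₁)) + (4 + κ₁) * (π * Real.sqrt 2)) / (B.Dtmin - κ₁) := by
  intro θ e he
  have h2ne : (2 : WithTop ℕ∞) ≠ 0 := by norm_num
  obtain ⟨hl, hh⟩ := shell_level_admissible hlo hhi he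
  have hu : ∀ ϑ, IsBandFermiRadius (μ + e - δ (perturbedFermiRadius δ (μ + e) ϑ • dir ϑ)) ϑ (perturbedFermiRadius δ (μ + e) ϑ) :=
    isBandFermiRadius_perturbedFermiRadius B hδs.continuous hδ hl hh
  have hsq := abs_apply_le_pi_of_isBandFermiRadius (hu θ)
  have hκ₁0 : 0 ≤ κ₁ := le_trans (norm_nonneg _) (hκ _ hsq)
  have hκ₂0 : 0 ≤ κ₂ := (norm_nonneg (fderiv ℝ (fderiv ℝ δ) _)).trans (hκ₂ _ hsq)
  have hden : 0 < B.Dtmin - κ₁ := sub_pos.2 hκ₁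
  have hsm := B.smax_pos
  have hupos : 0 < perturbedFermiRadius δ (μ + e) θ := (mem_Ioo_of_shifted B hδ hl hh (hu θ)).1
  have hule : perturbedFermiRadius δ (μ + e) θ ≤ π * Real.sqrt 2 := root_le_pi_mul_sqrt_two B hδ hl hh hu θ
  -- the three individual bounds
  have h0 : |perturbedFermiRadius δ (μ + e) θ| ≤ π * Real.sqrt 2 := by rw [abs_of_pos hupos]; exact hule
  have h1 : |deriv (perturbedFermiRadius δ (μ + e)) θ| ≤ (4 + κ₁) * (π * Real.sqrt 2) / (B.Dtmin - κ₁) := by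
    refine (abs_deriv_le B hδs h2ne hδ hl hh hκ hκ₁ hu θ).trans ?_
    exact div_le_div_of_nonneg_right (mul_le_mul_of_nonneg_left hule (by linarith)) hden.le
  have h2 := abs_second_deriv_le B hδs hδ hl hh hκ hκ₁ hκ₂ hu θ
  -- nonnegativity of the three summands
  have hA0 : 0 ≤ π * Real.sqrt 2 := by positivity
  have hB0 : 0 ≤ (4 + κ₁) * (π * Real.sqrt 2) / (B.Dtmin - κ₁) := by positivity
  have hC0 : 0 ≤ ((4 + κ₂) * (B.smax + κ₁ * (π * Real.sqrt 2 + 2 * B.smax) / (B.Dtmin - κ₁)) ^ 2 +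
      (8 + 2 * κ₁) * ((4 + κ₁) * (π * Real.sqrt 2) / (B.Dtmin - κ₁)) + (4 + κ₁) * (π * Real.sqrt 2)) / (B.Dtmin - κ₁) := by
    positivity
  refine ⟨?_, ?_, ?_⟩
  · exact h0.trans (by linarith)
  · rw [radiusDeriv_chart]; exact h1.trans (by linarith)
  · rw [radiusDeriv₂_chart]; exact h2.trans (by linarith)

/-- **Curvature lower bound on the shell** (BGM 2003 (2.8a) for the moving curve): under the convexity margin
`h_min ≤ 2h_E − κ₂S_E²`, `u_min h_min/((4 + κ₁)(2S_E)³) ≤ 1/r(θ, e)` for `|e| ≤ e₀`. [cite: BenfattoGiulianiMastropietro2003, §1.2 (2.8a)] -/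
theorem chart_curvature_ge
    (hconv : B.hmin ≤ 2 * (B.hmin - 4 * (κ₁ * (π * Real.sqrt 2 + 2 * B.smax) / (B.Dtmin - κ₁)) *
        ((B.smax + κ₁ * (π * Real.sqrt 2 + 2 * B.smax) / (B.Dtmin - κ₁)) + B.smax)) -
        κ₂ * (B.smax + κ₁ * (π * Real.sqrt 2 + 2 * B.smax) / (B.Dtmin - κ₁)) ^ 2) :
    ∀ θ e : ℝ, |e| ≤ e₀ →
      B.umin * B.hmin / ((4 + κ₁) * (2 * (B.smax + κ₁ * (π * Real.sqrt 2 + 2 * B.smax) / (B.Dtmin - κ₁))) ^ 3) ≤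
        BGM2003.curvature (fun ϑ e => perturbedFermiRadius δ (μ + e) ϑ) θ e := by
  intro θ e he
  obtain ⟨hl, hh⟩ := shell_level_admissible hlo hhi he
  have hu : ∀ ϑ, IsBandFermiRadius (μ + e - δ (perturbedFermiRadius δ (μ + e) ϑ • dir ϑ)) ϑ (perturbedFermiRadius δ (μ + e) ϑ) :=
    isBandFermiRadius_perturbedFermiRadius B hδs.continuous hδ hl hh
  have hsq := abs_apply_le_pi_of_isBandFermiRadius (hu θ)
  have hκ₁0 : 0 ≤ κ₁ := le_trans (norm_nonneg _) (hκ _ hsq)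
  have hsm := B.smax_pos; have hum := B.umin_pos; have hhm := B.hmin_pos
  have hden : 0 < B.Dtmin - κ₁ := sub_pos.2 hκ₁
  have hpos : 0 ≤ 2 * (B.hmin - 4 * (κ₁ * (π * Real.sqrt 2 + 2 * B.smax) / (B.Dtmin - κ₁)) *
      ((B.smax + κ₁ * (π * Real.sqrt 2 + 2 * B.smax) / (B.Dtmin - κ₁)) + B.smax)) -
      κ₂ * (B.smax + κ₁ * (π * Real.sqrt 2 + 2 * B.smax) / (B.Dtmin - κ₁)) ^ 2 := hhm.le.trans hconv
  have h := polarCurvature_perturbed_ge B hδs hδ hl hh hκ hκ₁ hκ₂ hu θ hpos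
  rw [curvature_chart]
  refine le_trans ?_ h
  have hSE0 : 0 ≤ B.smax + κ₁ * (π * Real.sqrt 2 + 2 * B.smax) / (B.Dtmin - κ₁) := by positivity
  exact div_le_div_of_nonneg_right (mul_le_mul_of_nonneg_left hconv hum.le) (by positivity)

end Shell

end Summit.HubbardSuperconductivity.HubbardSuperconductivity.Theorems.PerturbedFermiCurve

end
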